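import Summits.CriticalPhenomena.PercolationContinuityZ3.Theorems.PercNearOneGluingAdditiveGluingCovTransferCertCheck

/-!
# `AdditiveGluing` (crux stmt-CriticalPhenomena-4576): exact rational evaluation of connectivity-event probabilities
# on a weighted `K_n` (witness evaluation for refutations and for spot checks of certificates)

Support file (certificate seat `prim-cert-2`; `--supports stmt-CriticalPhenomena-4576`).  For a list `xs` of rational edge
weights (indexed like `edgeE n`, i.e. the pairs `(i, j)`, `i < j`, in lexicographic order) the weight vector `wtab n xs hx`
of `K_n` is defined, and for every Boolean connectivity predicate `P` (`connEvent P` of `…CovTransferCertCheck`)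

  `(prodBernoulli (wtab n xs hx)).real (connEvent P) = mlL (mE n) (table of P) xs`        (`real_connEvent_eq_mlL`),

where `mlL` evaluates the multilinear polynomial of an integer list table at a rational point by halving (exact rational
arithmetic, `2^m` leaves).  `evalQs n xs Ps` evaluates a list of predicates sharing the reach tables; `real_connEvent_of_evalQs`
turns one `native_decide`/`decide` evaluation `evalQs n xs Ps = qs` into the real identities.  This is the tool by which an
explicit weighted graph refutes a conjectured inequality between products of connection probabilities (first client:
`…SetGlueWcSRefutation`).  Nothing here asserts anything about the crux.
-/

namespace Summit.CriticalPhenomena.PercolationContinuityZ3.Theorems.ConnEventEval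

open Finset MeasureTheory OneCutCert CovTransferCert
open scoped BigOperators
open Literature.Probability.Percolation Literature.Probability.LatticeModels

variable {n : ℕ}

/-! ## Evaluation of a multilinear polynomial at a rational point, by halving -/

/-- `mlL L l xs`: the multilinear polynomial of the integer list table `l` (length `2^L`, bitmask-indexed) evaluated at the
point `(xs[0], …, xs[L-1])`, computed by splitting off the top coordinate. [this work] -/
def mlL : ℕ → List ℤ → List ℚ → ℚ
  | 0, l, _ => (l.getD 0 0 : ℚ)
  | L + 1, l, xs => (1 - xs.getD L 0) * mlL L (l.take (2 ^ L)) xs + xs.getD L 0 * mlL L (l.drop (2 ^ L)) xs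

/-- Corner weights split off the top coordinate. [folklore] -/
theorem mono_snoc {L : ℕ} (x : Fin (L + 1) → ℝ) (g : Fin L → Bool) (b : Bool) :
    mono x (Fin.snoc g b) = mono (fun i => x (Fin.castSucc i)) g * (if b then x (Fin.last L) else 1 - x (Fin.last L)) := by
  unfold mono
  rw [Fin.prod_univ_castSucc]
  simp only [Fin.snoc_castSucc, Fin.snoc_last]

/-- **Correctness of `mlL`**: it is the multilinear polynomial `ML` of the table at the point. [this work] -/
theorem mlL_eq : ∀ (L : ℕ) (l : List ℤ) (xs : List ℚ), l.length = 2 ^ L →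
    ((mlL L l xs : ℚ) : ℝ) = ML (fun g => (tabOf (m := L) l g : ℝ)) (fun i => ((xs.getD (i : ℕ) 0 : ℚ) : ℝ))
  | 0, l, xs, _ => by
    unfold mlL ML mono tabOf
    simp [enc2]
  | L + 1, l, xs, hl => by
    have h1 : (l.take (2 ^ L)).length = 2 ^ L := by rw [List.length_take, hl, pow_succ]; omega
    have h2 : (l.drop (2 ^ L)).length = 2 ^ L := by rw [List.length_drop, hl, pow_succ]; omega
    unfold mlL
    push_cast
    rw [mlL_eq L _ xs h1, mlL_eq L _ xs h2]
    unfold ML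
    rw [sum_corner_succ, Finset.mul_sum, Finset.mul_sum]
    congr 1
    · refine Finset.sum_congr rfl fun g _ => ?_
      simp only [tabOf, mono_snoc, enc2_snoc, Bool.toNat_false, zero_mul, add_zero, Fin.val_castSucc, Fin.val_last,
        Bool.false_eq_true, if_false]
      rw [List.getD_eq_getElem?_getD (l := List.take (2 ^ L) l) (i := enc2 g), List.getD_eq_getElem?_getD (l := l) (i := enc2 g),
        List.getElem?_take_of_lt (enc2_lt g)]
      ring
    · refine Finset.sum_congr rfl fun g _ => ?_
      simp only [tabOf, mono_snoc, enc2_snoc, Bool.toNat_true, one_mul, Fin.val_castSucc, Fin.val_last, if_true]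
      rw [List.getD_eq_getElem?_getD (l := List.drop (2 ^ L) l) (i := enc2 g), List.getD_eq_getElem?_getD (l := l) (i := enc2 g + 2 ^ L),
        List.getElem?_drop, add_comm (2 ^ L)]
      ring

/-! ## Weight vectors from rational lists -/

/-- An entry `xs.getD i 0` is an element of `xs` or `0`. [folklore] -/
theorem getD_mem_or_zero (xs : List ℚ) (i : ℕ) : xs.getD i 0 ∈ xs ∨ xs.getD i 0 = 0 := by
  rw [List.getD_eq_getElem?_getD]
  cases h : xs[i]? with
  | none => right; simp
  | some q => left; simp only [Option.getD_some]; exact List.mem_of_getElem? h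

open Classical in
/-- The weight vector of `K_n` with rational weights `xs` (indexed like `edgeE n`; diagonal pairs get weight `0`). [this work] -/
noncomputable def wtab (n : ℕ) (xs : List ℚ) (hx : ∀ x ∈ xs, 0 ≤ x ∧ x ≤ 1) : Sym2 (Fin n) → unitInterval := fun e =>
  if h : ∃ i : Fin (mE n), edgeE n i = e then
    ⟨((xs.getD (Classical.choose h).val 0 : ℚ) : ℝ), by
      rcases getD_mem_or_zero xs (Classical.choose h).val with hm | h0
      · exact ⟨by exact_mod_cast (hx _ hm).1, by exact_mod_cast (hx _ hm).2⟩
      · rw [h0]; simp⟩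
  else 0

open Classical in
/-- The coordinates of `wtab`: `xOf (wtab n xs hx) i = xs[i]`. [this work] -/
theorem xOf_wtab (xs : List ℚ) (hx : ∀ x ∈ xs, 0 ≤ x ∧ x ≤ 1) (i : Fin (mE n)) :
    xOf (wtab n xs hx) i = ((xs.getD (i : ℕ) 0 : ℚ) : ℝ) := by
  unfold xOf wtab
  have h : ∃ j : Fin (mE n), edgeE n j = edgeE n i := ⟨i, rfl⟩
  rw [dif_pos h]
  have hj : Classical.choose h = i := edgeE_injective n (Classical.choose_spec h)
  simp only [hj]

/-! ## Evaluation of connectivity events -/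

/-- **Exact evaluation**: the probability of a connectivity event under `wtab n xs hx` is `mlL` of its table. [this work] -/
theorem real_connEvent_eq_mlL (xs : List ℚ) (hx : ∀ x ∈ xs, 0 ≤ x ∧ x ≤ 1) (P : CRel n → Bool) :
    (prodBernoulli (wtab n xs hx)).real (connEvent P) = ((mlL (mE n) ((evTab n P).map ((↑) : ℕ → ℤ)) xs : ℚ) : ℝ) := by
  rw [real_connEvent_eq_ML, show xOf (wtab n xs hx) = fun i : Fin (mE n) => ((xs.getD (i : ℕ) 0 : ℚ) : ℝ) from funext (xOf_wtab xs hx),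
    mlL_eq (mE n) _ xs (by rw [List.length_map, length_evTab])]
  rfl

/-- Exact rational evaluation of a list of connectivity events at the weights `xs`, sharing the reach tables. [this work] -/
def evalQs (n : ℕ) (xs : List ℚ) (Ps : List (CRel n → Bool)) : List ℚ :=
  let base := baseRT n
  Ps.map fun P => mlL (mE n) ((evTabRT base P).map ((↑) : ℕ → ℤ)) xs

/-- `evalQs` entrywise. [this work] -/
theorem evalQs_eq_map (xs : List ℚ) (Ps : List (CRel n → Bool)) :
    evalQs n xs Ps = Ps.map fun P => mlL (mE n) ((evTab n P).map ((↑) : ℕ → ℤ)) xs := rfl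

/-- **From one evaluation to the real identities**: if `evalQs n xs Ps = qs` then the `k`-th listed event has probability
`qs[k]`. [this work] -/
theorem real_connEvent_of_evalQs {xs : List ℚ} (hx : ∀ x ∈ xs, 0 ≤ x ∧ x ≤ 1) {Ps : List (CRel n → Bool)} {qs : List ℚ}
    (h : evalQs n xs Ps = qs) (k : ℕ) (hk : k < Ps.length) :
    (prodBernoulli (wtab n xs hx)).real (connEvent (Ps[k])) = ((qs.getD k 0 : ℚ) : ℝ) := by
  rw [real_connEvent_eq_mlL, ← h, evalQs_eq_map, List.getD_eq_getElem?_getD, List.getElem?_map,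
    List.getElem?_eq_getElem hk]
  rfl

end Summit.CriticalPhenomena.PercolationContinuityZ3.Theorems.ConnEventEval
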